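import Summits.QuantumFields.YangMills.Theorems.BalabanUVNodesN06SectDUnitsAtPinsPhys
import Literature.MathematicalPhysics.QuantumFieldTheory.Balaban1983to89.Node00.OpsYRecordV10

/-!
# BalabanUVNodes ∕ N06 ([B9], `Dag.B9_main`) — CASCADE-K PIECE K2 (director-ym №383): THE SECT.-D UNITS ∕ POSITIVITIES AT THE PINS (`…N06SectDUnitsAtPinsPhys` §1)
# RE-PRESSED ONCE OVER A GENERIC AVERAGING PAIR `(𝔮, 𝔮⋆)` AND AN AVERAGING TRANSPORTER `parS` (node00-def-Y's `Node00.OpsYSectDQ` letters)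

Track A of `YM-PLAN.md` (cell `pub-ymgap`, HUMAN RULING D-0062), node **N06** = [Balaban1985BackgroundPropagators] Thms 3.1–3.15; seat `pub-ymgap-dag-n06-d` (gen 24).
WHY.  `…N06SectDUnitsAtPinsPhys` (✓) turns rows 20–21's displayed form smallness `FormSmall 𝔬 r U` (`r < 1`) and row 17's positivity of `Δ_a(U)` into the three
units `Δ_{π,a}(U)`, `Δ⁽¹⁾(U)` and the trace positivity of `Δ⁽¹⁾(U)` that (3.122)∕(3.128)∕(3.138) need — with the letters PINNED to the straight averaging pair
`QY parBY ∕ QsY parBY` and the symmetrised transporter (`deltaPiAY ∕ deltaOneY ∕ deltaAY … (parSymY) (parBY) …`, models `S0coK … parSymY parBY …`).  The knit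
certificate (CASCADE-K) reads the SAME rows at node00-def-Y's `Q`-GENERIC Sect.-D letters `deltaPiAQY ∕ deltaOneQY ∕ deltaAQY i 𝔮 𝔮⋆ parS G′` (`Node00.OpsYSectDQ`)
at PRINT's pair `(qKnitOfRecord, qsKnitOfRecord)` and transporter `parKnitY`; e.g. `Node00.OpsYRecordV11Reg335.lettersYOfRecordV11K_isUnit_QGQOfQY_G₁_SU_of_regQY`
and `…_ids3152_SU_of_regQY` take exactly `hΔ1 : PosDefTr 1 (deltaOneQY …)` ∕ `hM1 : IsUnit (deltaOneQY …)`.  This file is the ONE parametric re-press of §1 of the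
pinned file: the pair `(𝔮, 𝔮⋆)` and the transporter `parS` are parameters, the pins read node00-def-Y's `𝔮`-generic models (stated here by their bodies,
`(c_R)⁻¹ • coordOpK b (Δ_a[𝔮] …)` = `Node00.OpsYOps312OfRecordPar.S0coKq …` definitionally), and the proofs are the landed ones with `deltaPiAY_eq_deltaAY_sub ↦
deltaPiAQY_eq_deltaAQY_sub`, `deltaOneY_eq_deltaAY_sub ↦ deltaOneQY_eq_deltaAQY_sub`, `deltaAY_GpPhysY ↦ deltaAQY_GpPhysY_eq`.  (§2 of the pinned file — the ten
definitional Sect.-D identities — needs node00-def-Y's `𝔮`-generic coordinate algebra and stays with the K0 owner.)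
* ★ `isUnit_deltaPiAQY_of_formSmall` · ★ `isUnit_deltaOneQY_of_formSmall` · ★ `posDefEnd_S0coKq_of_posDefTr` · ★★ `posDefTr_deltaOneQY_of_formSmall_pins` · ★ `isUnit_deltaAQY_phys_of_posDefTr`.
Instances: `(𝔮, 𝔮⋆, parS) := (QY parBY, QsY parBY, parSymY)` recovers §1 of the pinned file (node00-def-Y `S0coKq_QY`, `deltaAQY` at the straight pair = `deltaAY`);
the knit certificate reads `(qKnitOfRecord, qsKnitOfRecord, parKnitY)`.
HONEST FRAMING.  Mechanical re-press of finite-dimensional linear algebra over landed letters; `FormSmall` and the positivity of `Δ_a` stay HYPOTHESES; nothing of [B9]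
asserted; COUNT-NEUTRAL; N06 NOT discharged; K1⁹ NOT closed; one finite 𝕋⁴ programme at fixed `ε` — NOT continuum ∕ OS ∕ mass gap ∕ Clay.  0 `def`, 0 `sorry`.
[cite: Balaban1985BackgroundPropagators, (3.120)–(3.123) pp.419–420, (3.128) p.421, (3.134)–(3.138) pp.422–423, (3.26)–(3.27) p.395, (3.115) p.418, Thm 3.11 p.416;
Balaban1985Averaging, Prop. 2 p.26, (15) p.19]
-/

noncomputable section

namespace Summit.QuantumFields.YangMills.BalabanUVNodes.N06SectDUnitsAtPinsPhysQ

open Literature.MathematicalPhysics.QuantumFieldTheory.Balaban1983to89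
open Literature.MathematicalPhysics.QuantumFieldTheory.Balaban1983to89.Node00
open Literature.MathematicalPhysics.QuantumFieldTheory.Balaban1983to89.Node00.OpsYSectDCoords (TpicoK T2coK cR39_trBasis_pos coordOpK_sub coordOpK_add repr_assembleK)
open Literature.MathematicalPhysics.QuantumFieldTheory.Balaban1983to89.Node00.OpsYQLetter (QLetterY QsLetterY)
open Literature.MathematicalPhysics.QuantumFieldTheory.Balaban1983to89.B9CoReadingCoords (XBK assembleK coordOpK coordOpK_apply)
open Literature.MathematicalPhysics.QuantumFieldTheory.Balaban1983to89.B9CoReadingCoordsTranspose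
open Literature.MathematicalPhysics.QuantumFieldTheory.Balaban1983to89.B9Thm39ReadingCoords (cR39)
open Literature.MathematicalPhysics.QuantumFieldTheory.Balaban1983to89.B9Thm312Whole (Ops FormSmall PosDefEnd)
open Literature.MathematicalPhysics.QuantumFieldTheory.Balaban1983to89.B9Thm311ReadingCoords (isUnit_of_injective trIP PosDefTr)
open Literature.MathematicalPhysics.QuantumFieldTheory.Balaban1983to89.B6KLevelCensusIndexV1 (KIdx)
open Summit.QuantumFields.YangMills.BalabanUVNodes.N06SectDUnitsAtPins (injective_sub_of_form_bound injective_of_coordOpK_const injective_of_smul_injective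
  dotProduct_coordOpK_const_eq_sum_trIP posDefTr_of_posDefEnd_coordOpK_const)
open scoped Matrix
open scoped Matrix.Norms.L2Operator

variable {N : ℕ} {d ℓ : ℕ} {hd : 1 ≤ d + 1} {hL : Odd (ℓ + 1) ∧ 1 < ℓ + 1} {b₀ b₁ : ℝ}

/-- `TrIdx N` is inhabited for `0 < N`. [folklore] -/
private theorem nonempty_trIdx (hN : 0 < N) : Nonempty (TrIdx N) := ⟨(⟨0, hN⟩, ⟨0, hN⟩, 0)⟩

/-- the weighted trace pairing vanishes on a zero left argument. [cite: Balaban1985BackgroundPropagators, p.393 (scalar products), bookkeeping] -/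
private theorem trIP_zero_left {S : Type} [Fintype S] (w : S → ℝ) (Ψ : S → Matrix (Fin N) (Fin N) ℂ) : trIP w 0 Ψ = 0 := by
  simp [trIP]

/-- ★ **THE UNIT `Δ_{π,a}[𝔮](U) = Δ_a[𝔮] − Δ′_π` ((3.122)) FROM THE FORM SMALLNESS AT THE PINS, GENERIC PAIR AND TRANSPORTER** — `isUnit_deltaPiAY_of_formSmall_phys`
re-pressed: `S0 − Tpi` injective (`injective_sub_of_form_bound`) = `c⁻¹·coordOpK (Δ_a[𝔮] − Δ′_π)` (`deltaPiAQY_eq_deltaAQY_sub`) ⟹ `Δ_{π,a}[𝔮]` injective ⟹ unit.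
[cite: Balaban1985BackgroundPropagators, (3.120)–(3.122) pp.419–420, (3.115) p.418, Thm 3.11 p.416] -/
theorem isUnit_deltaPiAQY_of_formSmall (i : KIdx d ℓ hd hL b₀ b₁) (B : B9.Backgrounds) (cfg : B.Cfg → CfgY (Matrix (Fin N) (Fin N) ℂ) i)
    (𝔮 : QLetterY (Matrix (Fin N) (Fin N) ℂ) i) (𝔮s : QsLetterY (Matrix (Fin N) (Fin N) ℂ) i) (parS : SiteParY (Matrix (Fin N) (Fin N) ℂ) i)
    {g : B9.Geometry} {Y Z W : Type} [Fintype Y] [Fintype Z] [Fintype W]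
    (𝔬 : Ops g B (XBK (TrIdx N) i) Y Z W) (U : B.Cfg) {r : ℝ} (hN : 0 < N) (hF : FormSmall 𝔬 r U) (hr : r < 1)
    (hS0 : 𝔬.S0 U = (cR39 (trBasis N))⁻¹ • coordOpK (trBasis N) (fun _ : Fin (d + 1) => (deltaAQY i 𝔮 𝔮s parS (GpPhysY i parS) (cfg U)).restrictScalars ℝ))
    (hTpi : 𝔬.Tpi U = TpicoK i (trBasis N) B cfg parS (GpPhysY i parS) U) :
    IsUnit (deltaPiAQY i 𝔮 𝔮s parS (GpPhysY i parS) (cfg U)) := by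
  haveI : Nonempty (TrIdx N) := nonempty_trIdx hN
  have hinj : Function.Injective (𝔬.S0 U - 𝔬.Tpi U) := injective_sub_of_form_bound _ _ hF.posS0 hF.small hr
  have hEq : 𝔬.S0 U - 𝔬.Tpi U = (cR39 (trBasis N))⁻¹ •
      coordOpK (trBasis N) (fun _ : Fin (d + 1) => (deltaPiAQY i 𝔮 𝔮s parS (GpPhysY i parS) (cfg U)).restrictScalars ℝ) := by
    have hfam : (fun _ : Fin (d + 1) => (deltaPiAQY i 𝔮 𝔮s parS (GpPhysY i parS) (cfg U)).restrictScalars ℝ) =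
        fun _ : Fin (d + 1) => (deltaAQY i 𝔮 𝔮s parS (GpPhysY i parS) (cfg U)).restrictScalars ℝ -
          (deltaPiPrimeY i parS (GpPhysY i parS) (cfg U)).restrictScalars ℝ := by
      funext ν
      apply LinearMap.ext
      intro v
      simp only [LinearMap.coe_restrictScalars, LinearMap.sub_apply, deltaPiAQY_eq_deltaAQY_sub]
    rw [hS0, hTpi, hfam, coordOpK_sub, smul_sub]
    rfl
  rw [hEq] at hinj
  have hinj2 := injective_of_coordOpK_const (trBasis N) _ (injective_of_smul_injective hinj)
  exact isUnit_of_injective (fun u v huv => hinj2 (by simpa only [LinearMap.coe_restrictScalars] using huv))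

/-- ★ **THE UNIT `Δ⁽¹⁾[𝔮](U) = Δ_a[𝔮] − Δ′_π − Δ⁽²⁾_π` ((3.128)) FROM THE FORM SMALLNESS AT THE PINS, GENERIC PAIR AND TRANSPORTER** (`isUnit_deltaOneY_of_formSmall_phys`
re-pressed; `deltaOneQY_eq_deltaAQY_sub`). [cite: Balaban1985BackgroundPropagators, (3.128) p.421, (3.134)–(3.137) pp.422–423, (3.115) p.418, Thm 3.11 p.416] -/
theorem isUnit_deltaOneQY_of_formSmall (i : KIdx d ℓ hd hL b₀ b₁) (B : B9.Backgrounds) (cfg : B.Cfg → CfgY (Matrix (Fin N) (Fin N) ℂ) i)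
    (𝔮 : QLetterY (Matrix (Fin N) (Fin N) ℂ) i) (𝔮s : QsLetterY (Matrix (Fin N) (Fin N) ℂ) i) (parS : SiteParY (Matrix (Fin N) (Fin N) ℂ) i)
    (Δ2 : BondOpY (Matrix (Fin N) (Fin N) ℂ) i) {g : B9.Geometry} {Y Z W : Type} [Fintype Y] [Fintype Z] [Fintype W]
    (𝔬 : Ops g B (XBK (TrIdx N) i) Y Z W) (U : B.Cfg) {r : ℝ} (hN : 0 < N) (hF : FormSmall 𝔬 r U) (hr : r < 1)
    (hS0 : 𝔬.S0 U = (cR39 (trBasis N))⁻¹ • coordOpK (trBasis N) (fun _ : Fin (d + 1) => (deltaAQY i 𝔮 𝔮s parS (GpPhysY i parS) (cfg U)).restrictScalars ℝ))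
    (hTpi : 𝔬.Tpi U = TpicoK i (trBasis N) B cfg parS (GpPhysY i parS) U)
    (hT2 : 𝔬.T2 U = T2coK i (trBasis N) B cfg parS (GpPhysY i parS) Δ2 U) :
    IsUnit (deltaOneQY i 𝔮 𝔮s parS (GpPhysY i parS) Δ2 (cfg U)) := by
  haveI : Nonempty (TrIdx N) := nonempty_trIdx hN
  have hinj : Function.Injective (𝔬.S0 U - (𝔬.Tpi U + 𝔬.T2 U)) := injective_sub_of_form_bound _ _ hF.posS0 hF.small1 hr
  have hEq : 𝔬.S0 U - (𝔬.Tpi U + 𝔬.T2 U) = (cR39 (trBasis N))⁻¹ •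
      coordOpK (trBasis N) (fun _ : Fin (d + 1) => (deltaOneQY i 𝔮 𝔮s parS (GpPhysY i parS) Δ2 (cfg U)).restrictScalars ℝ) := by
    have hfam : (fun _ : Fin (d + 1) => (deltaOneQY i 𝔮 𝔮s parS (GpPhysY i parS) Δ2 (cfg U)).restrictScalars ℝ) =
        fun _ : Fin (d + 1) => (deltaAQY i 𝔮 𝔮s parS (GpPhysY i parS) (cfg U)).restrictScalars ℝ -
          ((deltaPiPrimeY i parS (GpPhysY i parS) (cfg U)).restrictScalars ℝ +
            (delta2PiY i parS (GpPhysY i parS) Δ2 (cfg U)).restrictScalars ℝ) := by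
      funext ν
      apply LinearMap.ext
      intro v
      simp only [LinearMap.coe_restrictScalars, LinearMap.sub_apply, LinearMap.add_apply, deltaOneQY_eq_deltaAQY_sub]
    rw [hS0, hTpi, hT2, hfam, coordOpK_sub, coordOpK_add, smul_sub, smul_add]
    rfl
  rw [hEq] at hinj
  have hinj2 := injective_of_coordOpK_const (trBasis N) _ (injective_of_smul_injective hinj)
  exact isUnit_of_injective (fun u v huv => hinj2 (by simpa only [LinearMap.coe_restrictScalars] using huv))

/-- ★ **`FormSmall.posS0` AT THE PINS FROM ROW 17's POSITIVITY OF `Δ_a[𝔮](U)`, GENERIC PAIR AND TRANSPORTER** (`posDefEnd_S0coK_of_posDefTr_phys` re-pressed):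
`PosDefTr 1 (deltaAQY …)` gives the real-coordinate positivity of the model `c⁻¹·coordOpK (Δ_a[𝔮])`, slice by slice.
[cite: Balaban1985BackgroundPropagators, Thm 3.11 p.416, (3.26) p.395, (3.115) p.418, (3.120) p.419] -/
theorem posDefEnd_S0coKq_of_posDefTr (i : KIdx d ℓ hd hL b₀ b₁) (U : CfgY (Matrix (Fin N) (Fin N) ℂ) i)
    (𝔮 : QLetterY (Matrix (Fin N) (Fin N) ℂ) i) (𝔮s : QsLetterY (Matrix (Fin N) (Fin N) ℂ) i) (parS : SiteParY (Matrix (Fin N) (Fin N) ℂ) i)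
    (Gp : SiteOpY (Matrix (Fin N) (Fin N) ℂ) i) (hN : 0 < N) (hΔ : PosDefTr (fun _ => (1 : ℝ)) (deltaAQY i 𝔮 𝔮s parS Gp U)) :
    PosDefEnd ((cR39 (trBasis N))⁻¹ • coordOpK (trBasis N) (fun _ : Fin (d + 1) => (deltaAQY i 𝔮 𝔮s parS Gp U).restrictScalars ℝ)) := by
  classical
  intro f hf
  have hc : 0 < cR39 (trBasis N) := cR39_trBasis_pos hN
  obtain ⟨p, hp⟩ : ∃ p, f p ≠ 0 := by
    by_contra h
    exact hf (funext fun q => not_not.mp (not_exists.mp h q))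
  have hA : assembleK (trBasis N) p.2.1 p.2.2.2 f ≠ 0 := by
    intro h0
    have h1 := repr_assembleK (trBasis N) f p.1 p.2.1 p.2.2.1 p.2.2.2
    rw [h0] at h1
    simp only [Pi.zero_apply, map_zero, Finsupp.coe_zero] at h1
    exact hp h1.symm
  have hform : f ⬝ᵥ ((cR39 (trBasis N))⁻¹ • coordOpK (trBasis N) (fun _ : Fin (d + 1) => (deltaAQY i 𝔮 𝔮s parS Gp U).restrictScalars ℝ)) f =
      (cR39 (trBasis N))⁻¹ * ∑ ν : Fin (d + 1), ∑ c' : TrIdx N, trIP (fun _ => (1 : ℝ)) (assembleK (trBasis N) ν c' f)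
        ((deltaAQY i 𝔮 𝔮s parS Gp U).restrictScalars ℝ (assembleK (trBasis N) ν c' f)) := by
    rw [← dotProduct_coordOpK_const_eq_sum_trIP]
    simp only [LinearMap.smul_apply, dotProduct_smul, smul_eq_mul]
  rw [hform]
  refine mul_pos (inv_pos.mpr hc) ?_
  have hnn : ∀ (ν : Fin (d + 1)) (c' : TrIdx N), 0 ≤ trIP (fun _ => (1 : ℝ)) (assembleK (trBasis N) ν c' f)
      ((deltaAQY i 𝔮 𝔮s parS Gp U).restrictScalars ℝ (assembleK (trBasis N) ν c' f)) := fun ν c' => by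
    by_cases h0 : assembleK (trBasis N) ν c' f = 0
    · rw [h0, map_zero, trIP_zero_left]
    · exact (hΔ _ h0).le
  have hpos : 0 < trIP (fun _ => (1 : ℝ)) (assembleK (trBasis N) p.2.1 p.2.2.2 f)
      ((deltaAQY i 𝔮 𝔮s parS Gp U).restrictScalars ℝ (assembleK (trBasis N) p.2.1 p.2.2.2 f)) := hΔ _ hA
  calc (0 : ℝ) < _ := hpos
    _ ≤ ∑ c' : TrIdx N, trIP (fun _ => (1 : ℝ)) (assembleK (trBasis N) p.2.1 c' f)
          ((deltaAQY i 𝔮 𝔮s parS Gp U).restrictScalars ℝ (assembleK (trBasis N) p.2.1 c' f)) :=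
        Finset.single_le_sum (fun c' _ => hnn p.2.1 c') (Finset.mem_univ p.2.2.2)
    _ ≤ _ := Finset.single_le_sum (fun ν _ => Finset.sum_nonneg fun c' _ => hnn ν c') (Finset.mem_univ p.2.1)

/-- ★★ **`Δ⁽¹⁾[𝔮](U)` IS POSITIVE IN TRACE CURRENCY FROM THE FORM SMALLNESS AT THE PINS, GENERIC PAIR AND TRANSPORTER** — the `hΔ1` input of node00-def-Y's
`lettersYOfRecordV11K_isUnit_QGQOfQY_G₁[_SU]_of_regQY` ([4] (2.35) «QGQ* is positive also») at the knit letters (`posDefTr_deltaOneY_of_formSmall_pins_phys` re-pressed).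
[cite: Balaban1985BackgroundPropagators, (3.128) p.421, (3.134)–(3.138) pp.422–423, (3.115) p.418, Thm 3.11 p.416; Balaban1984PropagatorsII, (2.35) p.229] -/
theorem posDefTr_deltaOneQY_of_formSmall_pins (i : KIdx d ℓ hd hL b₀ b₁) (B : B9.Backgrounds) (cfg : B.Cfg → CfgY (Matrix (Fin N) (Fin N) ℂ) i)
    (𝔮 : QLetterY (Matrix (Fin N) (Fin N) ℂ) i) (𝔮s : QsLetterY (Matrix (Fin N) (Fin N) ℂ) i) (parS : SiteParY (Matrix (Fin N) (Fin N) ℂ) i)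
    (Δ2 : BondOpY (Matrix (Fin N) (Fin N) ℂ) i) {g : B9.Geometry} {Y Z W : Type} [Fintype Y] [Fintype Z] [Fintype W]
    (𝔬 : Ops g B (XBK (TrIdx N) i) Y Z W) (U : B.Cfg) {r : ℝ} (hN : 0 < N) (hF : FormSmall 𝔬 r U) (hr : r < 1)
    (hS0 : 𝔬.S0 U = (cR39 (trBasis N))⁻¹ • coordOpK (trBasis N) (fun _ : Fin (d + 1) => (deltaAQY i 𝔮 𝔮s parS (GpPhysY i parS) (cfg U)).restrictScalars ℝ))
    (hTpi : 𝔬.Tpi U = TpicoK i (trBasis N) B cfg parS (GpPhysY i parS) U)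
    (hT2 : 𝔬.T2 U = T2coK i (trBasis N) B cfg parS (GpPhysY i parS) Δ2 U) :
    PosDefTr (fun _ => (1 : ℝ)) (deltaOneQY i 𝔮 𝔮s parS (GpPhysY i parS) Δ2 (cfg U)) := by
  have hc : 0 < cR39 (trBasis N) := cR39_trBasis_pos hN
  have hposR : PosDefEnd (𝔬.S0 U - (𝔬.Tpi U + 𝔬.T2 U)) := fun f hf => by
    have h0 : 0 < f ⬝ᵥ 𝔬.S0 U f := hF.posS0 f hf
    have h1 : f ⬝ᵥ (𝔬.Tpi U + 𝔬.T2 U) f ≤ r * (f ⬝ᵥ 𝔬.S0 U f) := (abs_le.mp (hF.small1 f)).2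
    have h2 : r * (f ⬝ᵥ 𝔬.S0 U f) < f ⬝ᵥ 𝔬.S0 U f := mul_lt_of_lt_one_left h0 hr
    rw [LinearMap.sub_apply, dotProduct_sub]
    linarith
  have hEq : 𝔬.S0 U - (𝔬.Tpi U + 𝔬.T2 U) = (cR39 (trBasis N))⁻¹ •
      coordOpK (trBasis N) (fun _ : Fin (d + 1) => (deltaOneQY i 𝔮 𝔮s parS (GpPhysY i parS) Δ2 (cfg U)).restrictScalars ℝ) := by
    have hfam : (fun _ : Fin (d + 1) => (deltaOneQY i 𝔮 𝔮s parS (GpPhysY i parS) Δ2 (cfg U)).restrictScalars ℝ) =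
        fun _ : Fin (d + 1) => (deltaAQY i 𝔮 𝔮s parS (GpPhysY i parS) (cfg U)).restrictScalars ℝ -
          ((deltaPiPrimeY i parS (GpPhysY i parS) (cfg U)).restrictScalars ℝ +
            (delta2PiY i parS (GpPhysY i parS) Δ2 (cfg U)).restrictScalars ℝ) := by
      funext ν
      apply LinearMap.ext
      intro v
      simp only [LinearMap.coe_restrictScalars, LinearMap.sub_apply, LinearMap.add_apply, deltaOneQY_eq_deltaAQY_sub]
    rw [hS0, hTpi, hT2, hfam, coordOpK_sub, coordOpK_add, smul_sub, smul_add]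
    rfl
  rw [hEq] at hposR
  have hposR' : PosDefEnd (coordOpK (trBasis N)
      (fun _ : Fin (d + 1) => (deltaOneQY i 𝔮 𝔮s parS (GpPhysY i parS) Δ2 (cfg U)).restrictScalars ℝ)) := fun f hf => by
    have h := hposR f hf
    rw [LinearMap.smul_apply, dotProduct_smul, smul_eq_mul] at h
    exact (mul_pos_iff_of_pos_left (inv_pos.mpr hc)).mp h
  exact posDefTr_of_posDefEnd_coordOpK_const hN _ hposR'

/-- ★ the unit `Δ_a[𝔮](U)` at `G′_phys` from the displayed positivity of `Δ_a[𝔮](U)` at `G′_latt` (the SAME operator, node00-def-Y `deltaAQY_GpPhysY_eq`).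
[cite: Balaban1985BackgroundPropagators, (3.26)–(3.27) p.395, (3.115) p.418, Thm 3.11 p.416] -/
theorem isUnit_deltaAQY_phys_of_posDefTr (i : KIdx d ℓ hd hL b₀ b₁) {U : CfgY (Matrix (Fin N) (Fin N) ℂ) i}
    (𝔮 : QLetterY (Matrix (Fin N) (Fin N) ℂ) i) (𝔮s : QsLetterY (Matrix (Fin N) (Fin N) ℂ) i) (parS : SiteParY (Matrix (Fin N) (Fin N) ℂ) i)
    (hΔA : PosDefTr (fun _ => (1 : ℝ)) (deltaAQY i 𝔮 𝔮s parS (GpY i parS) U)) :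
    IsUnit (deltaAQY i 𝔮 𝔮s parS (GpPhysY i parS) U) := by
  rw [deltaAQY_GpPhysY_eq]
  exact B9Thm311ReadingCoords.isUnit_of_posDefTr hΔA

end Summit.QuantumFields.YangMills.BalabanUVNodes.N06SectDUnitsAtPinsPhysQ

end
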